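import Mathlib.RingTheory.Flat.FaithfullyFlat.Algebra
import Mathlib.RingTheory.KrullDimension.Basic
import Mathlib.RingTheory.LocalRing.RingHom.Basic
import Literature.RingTheory.TightClosure.TightClosure
import HarnessLib

/-!
# Flat descent of F-rationality, inline form (crux `FrobeniusLadder.FRationalModification`, line `Sketch`)

Stub `stub_flatDescent` of the skeleton `Sketch` for crux stmt-ResolutionOfSingularities-15316
(card `flatten-the-alteration`, lemma "FlatDescentTight"). Let `R → S` be a faithfully flat
homomorphism of local rings with `dim S = dim R` and zero-dimensional closed fibre
(`𝔪_S ⊆ rad(𝔪_R S)`), `S` a domain of characteristic `p` which is F-rational in the sense of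
`Literature.RingTheory.TightClosure.IsFRational` (every ideal generated by a system of parameters is
tightly closed, Fedder–Watanabe 1989, Def. 1.10). Then `R` is a domain (`R ↪ S`) and `R` satisfies
the crux's inline per-stalk clause: for every system of parameters `s` of `R` (`dim R` elements
generating an ideal with maximal radical), `c ≠ 0` and `c · y^(p^e) ∈ span {z^(p^e) | z ∈ (s)}` for
all `e` force `y ∈ (s)`.

Proof (the elementary half of Hochster–Huneke 1994, §4/§6, flat base change): the image `s'` of `s`
in `S` is again a system of parameters (`dim S = dim R`, and `rad((s)S) = 𝔪_S` from the fibre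
hypothesis and `IsLocalHom`), `c` stays nonzero and the equations extend along `R → S`, so the image
of `y` lies in `(s)S` by F-rationality of `S`; finally `(s)S ∩ R = (s)` by faithful flatness
(`Ideal.comap_map_eq_self_of_faithfullyFlat`).
-/

-- the problem path `ResolutionOfSingularities/ResolutionOfSingularities` forces a duplicated segment
set_option linter.dupNamespace false

namespace Summit.ResolutionOfSingularities.ResolutionOfSingularities.Theorems.FRationalModification.FlatDescent

open IsLocalRing Literature.RingTheory.TightClosure

/-- Pushing a tight-closure membership test forward along a ring homomorphism `f : R →+* S`: if
`c * y ^ q ∈ span ((· ^ q) '' I)` in `R`, then `f c * (f y) ^ q ∈ span ((· ^ q) '' (I.map f))` in `S`.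
[folklore] -/
theorem map_mem_span_pow_image {R S : Type*} [CommRing R] [CommRing S] (f : R →+* S) (q : ℕ)
    (I : Ideal R) {y c : R}
    (hmem : c * y ^ q ∈ Ideal.span ((fun z : R => z ^ q) '' (I : Set R))) :
    f c * f y ^ q ∈ Ideal.span ((fun z : S => z ^ q) '' (I.map f : Set S)) := by
  have h1 : f (c * y ^ q) ∈ (Ideal.span ((fun z : R => z ^ q) '' (I : Set R))).map f :=
    Ideal.mem_map_of_mem _ hmem
  rw [map_mul, map_pow, Ideal.map_span] at h1
  refine Ideal.span_mono ?_ h1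
  rintro _ ⟨_, ⟨z, hz, rfl⟩, rfl⟩
  exact ⟨f z, Ideal.mem_map_of_mem f hz, (map_pow f z q).symm⟩

/-- The extension of a system of parameters along a faithfully flat local homomorphism `R → S` of
local rings with `dim S = dim R` and zero-dimensional closed fibre (`𝔪_S ⊆ rad(𝔪_R S)`) is a system
of parameters of `S`. [folklore] -/
theorem isSystemOfParameters_comp_algebraMap {R S : Type*} [CommRing R] [CommRing S]
    [IsLocalRing R] [IsLocalRing S] [Algebra R S] [IsLocalHom (algebraMap R S)]
    (hdim : ringKrullDim S = ringKrullDim R)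
    (hfib : maximalIdeal S ≤ ((maximalIdeal R).map (algebraMap R S)).radical)
    {d : ℕ} (hd : ringKrullDim R = d) {s : Fin d → R}
    (hs : (Ideal.span (Set.range s)).radical.IsMaximal) :
    IsSystemOfParameters (algebraMap R S ∘ s) := by
  have hsR : (Ideal.span (Set.range s)).radical = maximalIdeal R := eq_maximalIdeal hs
  refine And.intro (hdim.trans hd) ?_
  rw [Set.range_comp, ← Ideal.map_span]
  refine le_antisymm ((maximalIdeal.isMaximal S).isPrime.radical_le_iff.mpr ?_) ?_
  · exact (Ideal.map_mono (Ideal.le_radical.trans hsR.le)).trans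
      (map_maximalIdeal_le (algebraMap R S))
  · refine hfib.trans (Ideal.radical_le_radical_iff.mpr ?_)
    rw [← hsR]
    exact Ideal.map_radical_le (f := algebraMap R S)

/-- STUB `stub_flatDescent` — **flat descent of F-rationality, inline conclusion**: `R → S` a
faithfully flat homomorphism of local rings with `dim S = dim R` and `𝔪_S ⊆ rad(𝔪_R S)`
(zero-dimensional closed fibre), `S` a domain of characteristic `p` all of whose ideals generated by
a system of parameters are tightly closed. Then `R` is a domain (`R ↪ S`) and every ideal of `R`
generated by a system of parameters `s` satisfies the crux's clause: `c ≠ 0`,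
`c · y^(p^e) ∈ (s)^[p^e]` for all `e` ⇒ `y ∈ (s)` (`s` stays a system of parameters of `S`, `c` stays
`≠ 0`, the equations extend, and `y ∈ (s)S ∩ R = (s)R` by faithful flatness).
[cite: HochsterHuneke1994, (4.1)–(4.2) (base change of tight closure); folklore] -/
theorem stub_flatDescent (p : ℕ) [Fact p.Prime] {R S : Type*} [CommRing R] [CommRing S]
    [IsLocalRing R] [IsLocalRing S] [IsDomain S] [CharP S p] [Algebra R S]
    [Module.FaithfullyFlat R S]
    (hdim : ringKrullDim S = ringKrullDim R)
    (hfib : maximalIdeal S ≤ ((maximalIdeal R).map (algebraMap R S)).radical)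
    (hS : IsFRational S p) :
    IsDomain R ∧ ∀ d : ℕ, ringKrullDim R = d → ∀ s : Fin d → R,
      (Ideal.span (Set.range s)).radical.IsMaximal → ∀ y c : R, c ≠ 0 →
        (∀ e : ℕ, c * y ^ p ^ e ∈
          Ideal.span ((fun z : R => z ^ p ^ e) '' (Ideal.span (Set.range s) : Set R))) →
        y ∈ Ideal.span (Set.range s) := by
  have hinj : Function.Injective (algebraMap R S) := FaithfulSMul.algebraMap_injective R S
  refine ⟨Function.Injective.isDomain (algebraMap R S) hinj, ?_⟩
  intro d hd s hs y c hc hmem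
  have hI : Ideal.span (Set.range (algebraMap R S ∘ s)) =
      (Ideal.span (Set.range s)).map (algebraMap R S) := by
    rw [Set.range_comp, ← Ideal.map_span]
  have htc := hS _ (isSystemOfParameters_comp_algebraMap hdim hfib hd hs)
  rw [isTightlyClosed_iff_of_isDomain p, hI] at htc
  have hy : algebraMap R S y ∈ (Ideal.span (Set.range s)).map (algebraMap R S) :=
    htc _ (algebraMap R S c) ((map_ne_zero_iff _ hinj).mpr hc) fun e =>
      map_mem_span_pow_image (algebraMap R S) (p ^ e) _ (hmem e)
  rwa [← Ideal.comap_map_eq_self_of_faithfullyFlat (B := S) (Ideal.span (Set.range s)),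
    Ideal.mem_comap]

end Summit.ResolutionOfSingularities.ResolutionOfSingularities.Theorems.FRationalModification.FlatDescent
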